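import Literature.Barriers.CriticalPhenomena.PlaquetteWalkHoleRootExtremeColumns
import HarnessLib

/-!
# Barrier catalogue (SAWScalingLimit): the RIGHTMOST COLUMN of a class-`B2a` walk from a hole root — no `E` sides, singly visited,
entered from the west by a turn, left westwards by a turn or by a slanted end («RIGHT COLUMN»)

The east twin of `PlaquetteWalkHoleRootExtremeColumns` (leftmost column). No winding hypothesis is needed on this side: the walk
starts at the `W` side of the root plaquette, so even when `w` itself lies in the rightmost column its first arc does not use an `E`
side. With the leftmost column, the topmost and the bottommost rows (`PlaquetteWalkHoleRootExtremeRows`, `…WoundCost`) this completes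
the four extreme lines of a wound walk, each singly visited with turn(s) at its ends — the frame of the «rectangle» classification
(DESIGN-next b-engine-1 g24 §2bis).

* ★ `ΩG.forall_right_ne_E`, ★ `ΩG.right_single_visit`;
* ★★ `ΩG.exists_right_entry_turn` (the first arc in the rightmost column enters from `W` — from the west neighbour, or from the root
  edge when it is the first arc — and leaves vertically: a turn), ★★ `ΩG.right_exit_or_end`, ★★ `ΩG.two_right_turns`.

[GlazmanManolescu2019 §1 Fig. 1, Lemma 2.1; Glazman 2015 Lemma 3.1 (proof, pp. 6–7)]
-/

noncomputable section

namespace Literature.Probability.RandomPlanarGeometry.SAW.YangBaxter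

open Real
open Literature.Barriers.CriticalPhenomena.PlaquetteWalk

open private fc_fh fc_ne fh_add_Mv three_le_Mv from Literature.Probability.RandomPlanarGeometry.YangBaxterSAWGeneralDomain

namespace YBWalk

/-- The first arc of a walk from the hole root enters the root plaquette through `W` (private copy; the public statement lives in
`PlaquetteWalkHoleRootInitialRun`). [cite: Glazman2015WeightedSAW, Lemma 3.1 (proof, pp. 6–7)] -/
private theorem sIn_zero_eq_W' {D : Set Face} {w : Face} {z : MidEdge} (hh : holeFaceW w ∉ D) (γ : YBWalk D (w.side .W) z)
    (hn : 0 < γ.arcs.length) : γ.sIn 0 = .W := by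
  obtain ⟨hin, -⟩ := γ.side_sIn_eq_nth hn
  rw [γ.nth_zero, fc_zero_eq_root w hh γ hn] at hin
  exact Face.side_injective w hin

end YBWalk

namespace ΩG

variable {D : Set Face} {w r : Face} {ω : ΩG D (w.side .W) r}

/-- ★ **NO ARC OF THE RIGHTMOST COLUMN USES AN `E` SIDE** (`X` the maximal column): an `E`-entry or `E`-exit has a neighbour further
east; a final `E`-exit would return to an `r` further east or re-enter `r`; the first arc enters through `W`.
[cite: GlazmanManolescu2019, §1, Fig. 1; Lemma 2.1] [cite: Glazman2015WeightedSAW, Lemma 3.1 (proof, pp. 6–7)] -/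
theorem forall_right_ne_E (hh : holeFaceW w ∉ D) (hr : RootedFace D (w.side .W) r) (h : ω.IsB2a) {X : ℤ}
    (hX : ∀ j < ω.2.arcs.length, (ω.2.fc j).1 ≤ X) :
    ∀ k < ω.2.arcs.length, (ω.2.fc k).1 = X → ω.2.sIn k ≠ .E ∧ ω.2.sOut k ≠ .E := by
  intro k hk hcol
  have hlen : 0 < ω.2.arcs.length := by omega
  constructor
  · intro hE
    have hk1 : 1 ≤ k := by
      by_contra hlt
      have e0 : k = 0 := by omega
      have h0 := YBWalk.sIn_zero_eq_W' hh ω.2 hlen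
      rw [e0] at hE; rw [hE] at h0; exact absurd h0 (by decide)
    obtain ⟨hp, -⟩ := ω.2.fc_pred_eq_of_sIn_E hk hk1 hE
    have := hX (k - 1) (by omega); rw [hp] at this; simp only at this; omega
  · intro hE
    by_cases hlast : k + 1 < ω.2.arcs.length
    · obtain ⟨hs, -⟩ := ω.2.fc_succ_eq_of_sOut_E hlast hE
      have := hX (k + 1) hlast; rw [hs] at this; simp only at this; omega
    · have hlen1 : k + 1 = ω.2.arcs.length := by omega
      obtain ⟨-, hout⟩ := ω.2.side_sIn_eq_nth hk
      rw [hlen1, ω.2.nth_length, hE] at hout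
      have hF : ω.2.firstHitG < k := by
        by_contra hge
        have := three_le_Mv hr h; have := fh_add_Mv h; unfold ΩG.Mv at *; omega
      have hlastne : ω.2.fc k ≠ r := fc_ne ω hr h hF hk
      have hrcol : r.1 ≤ X := by
        have e := (fc_fh ω hr h).1
        have := hX ω.2.firstHitG (ω.fh_lt h); rw [e] at this; exact this
      rcases hfc : ω.2.fc k with ⟨x, y⟩
      rw [hfc] at hcol hout hlastne
      simp only at hcol
      have e : r.side ω.1 = .vert (x + 1) y := by rw [← hout]; rfl
      rcases eq_of_side_eq_vert e with ⟨h2, -⟩ | ⟨h2, -⟩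
      · have := congrArg Prod.fst h2; simp only at this; omega
      · exact hlastne (h2.trans (by simp)).symm

/-- ★ **THE RIGHTMOST COLUMN OF A CLASS-`B2a` WALK FROM A HOLE ROOT IS SINGLY VISITED.** [cite: GlazmanManolescu2019, §1, Fig. 1; Lemma 2.1] -/
theorem right_single_visit (hh : holeFaceW w ∉ D) (hr : RootedFace D (w.side .W) r) (h : ω.IsB2a) {X : ℤ}
    (hX : ∀ j < ω.2.arcs.length, (ω.2.fc j).1 ≤ X) {i j : ℕ} (hi : i < ω.2.arcs.length)
    (hj : j < ω.2.arcs.length) (hcol : (ω.2.fc i).1 = X) (he : ω.2.fc i = ω.2.fc j) : i = j :=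
  ω.2.eq_of_fc_eq_of_forall_ne_side .E (forall_right_ne_E hh hr h hX) hi hj hcol he

/-- The columns of the arcs, as a finite set; non-empty for a non-trivial walk. [folklore] -/
private theorem cols_nonempty' (hlen : 0 < ω.2.arcs.length) :
    ((Finset.range ω.2.arcs.length).image fun i => (ω.2.fc i).1).Nonempty :=
  ⟨(ω.2.fc 0).1, Finset.mem_image.2 ⟨0, Finset.mem_range.2 hlen, rfl⟩⟩

/-- ★★ **AN ENTRY TURN IN THE RIGHTMOST COLUMN**: the first arc lying in the rightmost column `X ≥ w.1` of a class-`B2a` walk from the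
hole root enters through `W` (from the west neighbour, or from the root edge when it is the walk's first arc) and leaves VERTICALLY —
a turn `W → N` or `W → S` in a singly visited plaquette. [cite: GlazmanManolescu2019, Lemma 2.1; §1, Fig. 1] -/
theorem exists_right_entry_turn (hh : holeFaceW w ∉ D) (hr : RootedFace D (w.side .W) r) (h : ω.IsB2a) :
    ∃ X : ℤ, w.1 ≤ X ∧ (∀ j < ω.2.arcs.length, (ω.2.fc j).1 ≤ X) ∧
      ∃ i, i < ω.2.arcs.length ∧ (ω.2.fc i).1 = X ∧ (∀ j < i, (ω.2.fc j).1 ≠ X) ∧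
        ω.2.sIn i = .W ∧ (ω.2.sOut i = .N ∨ ω.2.sOut i = .S) := by
  classical
  have hlen : 0 < ω.2.arcs.length := by have := ω.fh_lt h; omega
  set S := (Finset.range ω.2.arcs.length).image fun i => (ω.2.fc i).1 with hS
  have hne : S.Nonempty := cols_nonempty' hlen
  set X := S.max' hne with hXdef
  have hX : ∀ j < ω.2.arcs.length, (ω.2.fc j).1 ≤ X := fun j hj => by
    rw [hXdef]; exact Finset.le_max' S _ (by rw [hS]; exact Finset.mem_image.2 ⟨j, Finset.mem_range.2 hj, rfl⟩)
  have h0 : ω.2.fc 0 = w := fc_zero_eq_root w hh ω.2 hlen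
  have hXw : w.1 ≤ X := by have := hX 0 hlen; rw [h0] at this; exact this
  have hex : ∃ i, i < ω.2.arcs.length ∧ (ω.2.fc i).1 = X := by
    obtain ⟨i, hi, e⟩ := Finset.mem_image.1 (Finset.max'_mem S hne)
    exact ⟨i, Finset.mem_range.1 hi, e⟩
  let i₀ := Nat.find hex
  obtain ⟨hi₀, hcol₀⟩ : i₀ < ω.2.arcs.length ∧ (ω.2.fc i₀).1 = X := Nat.find_spec hex
  have hmin : ∀ j < i₀, ¬(j < ω.2.arcs.length ∧ (ω.2.fc j).1 = X) := fun j hj => Nat.find_min hex hj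
  have hne' := forall_right_ne_E hh hr h hX
  -- the entry is `W`: not `E` (rightmost), not vertical (the predecessor would lie in the same column); index `0` enters through `W` anyway
  have hW : ω.2.sIn i₀ = .W := by
    rcases Nat.eq_zero_or_pos i₀ with hz | hpos
    · have := YBWalk.sIn_zero_eq_W' hh ω.2 hlen; rw [← hz] at this; exact this
    · have hprev : (ω.2.fc (i₀ - 1)).1 ≠ X := fun e => hmin (i₀ - 1) (by omega) ⟨by omega, e⟩
      cases hs : ω.2.sIn i₀
      · rfl
      · exact absurd hs (hne' i₀ hi₀ hcol₀).1
      · exfalso; apply hprev; rw [ω.2.fc_pred_eq_of_sIn_S hi₀ hpos hs]; exact hcol₀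
      · exfalso; apply hprev; rw [ω.2.fc_pred_eq_of_sIn_N hi₀ hpos hs]; exact hcol₀
  have hsd := ω.2.sIn_ne_sOut hi₀
  rw [hW] at hsd
  have hNS : ω.2.sOut i₀ = .N ∨ ω.2.sOut i₀ = .S := by
    cases hs : ω.2.sOut i₀
    · exact absurd hs.symm hsd
    · exact absurd hs (hne' i₀ hi₀ hcol₀).2
    · exact Or.inr rfl
    · exact Or.inl rfl
  exact ⟨X, hXw, hX, i₀, hi₀, hcol₀, fun j hj e => hmin j hj ⟨by omega, e⟩, hW, hNS⟩

/-- ★★ **EXIT TURN OR END IN THE RIGHTMOST COLUMN**: the LAST arc lying in the rightmost column `X` either leaves through `W` after a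
vertical entry — a turn `N → W` / `S → W` (possibly as the walk's last arc, re-entering `r` from the east) —, or it is the walk's last
arc leaving VERTICALLY onto a slanted side of `r`, which then lies in column `X`; in the latter case the entry may be vertical too.
[cite: GlazmanManolescu2019, §1, Fig. 1; Lemma 2.1] -/
theorem right_exit_or_end (hh : holeFaceW w ∉ D) (hr : RootedFace D (w.side .W) r) (h : ω.IsB2a) {X : ℤ}
    (hX : ∀ j < ω.2.arcs.length, (ω.2.fc j).1 ≤ X) {i : ℕ} (hi : i < ω.2.arcs.length)
    (hcol : (ω.2.fc i).1 = X) (hmax : ∀ j, i < j → j < ω.2.arcs.length → (ω.2.fc j).1 ≠ X) :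
    (ω.2.sOut i = .W ∧ (ω.2.sIn i = .N ∨ ω.2.sIn i = .S)) ∨
      (i + 1 = ω.2.arcs.length ∧ (ω.1 = .N ∨ ω.1 = .S) ∧ r.1 = X ∧ (ω.2.sOut i = .N ∨ ω.2.sOut i = .S)) := by
  have hne' := forall_right_ne_E hh hr h hX
  obtain ⟨hEin, hEout⟩ := hne' i hi hcol
  have hsd := ω.2.sIn_ne_sOut hi
  -- if the exit is `W`, the entry is vertical (it is neither `W` = the exit nor `E`)
  by_cases hlast : i + 1 < ω.2.arcs.length
  · have hnext := hmax (i + 1) (by omega) hlast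
    have hW : ω.2.sOut i = .W := by
      cases hs : ω.2.sOut i
      · rfl
      · exact absurd hs hEout
      · exfalso; apply hnext; rw [ω.2.fc_succ_eq_of_sOut_S hlast hs]; exact hcol
      · exfalso; apply hnext; rw [ω.2.fc_succ_eq_of_sOut_N hlast hs]; exact hcol
    rw [hW] at hsd
    left; refine ⟨hW, ?_⟩
    cases hs : ω.2.sIn i
    · exact absurd hs hsd
    · exact absurd hs hEin
    · exact Or.inr rfl
    · exact Or.inl rfl
  · have hlen1 : i + 1 = ω.2.arcs.length := by omega
    cases hs : ω.2.sOut i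
    · rw [hs] at hsd
      left; refine ⟨rfl, ?_⟩
      cases hs' : ω.2.sIn i
      · exact absurd hs' hsd
      · exact absurd hs' hEin
      · exact Or.inr rfl
      · exact Or.inl rfl
    · exact absurd hs hEout
    · right
      obtain ⟨-, hout⟩ := ω.2.side_sIn_eq_nth hi
      rw [hlen1, ω.2.nth_length, hs] at hout
      rcases hfc : ω.2.fc i with ⟨x, y⟩
      rw [hfc] at hout hcol
      simp only at hcol
      have e : r.side ω.1 = .slant x y := by rw [← hout]; rfl
      rcases eq_of_side_eq_slant e with ⟨h2, hz⟩ | ⟨h2, hz⟩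
      · exact ⟨hlen1, Or.inr hz, by rw [h2]; exact hcol, Or.inr rfl⟩
      · exact ⟨hlen1, Or.inl hz, by rw [h2]; exact hcol, Or.inr rfl⟩
    · right
      obtain ⟨-, hout⟩ := ω.2.side_sIn_eq_nth hi
      rw [hlen1, ω.2.nth_length, hs] at hout
      rcases hfc : ω.2.fc i with ⟨x, y⟩
      rw [hfc] at hout hcol
      simp only at hcol
      have e : r.side ω.1 = .slant x (y + 1) := by rw [← hout]; rfl
      rcases eq_of_side_eq_slant e with ⟨h2, hz⟩ | ⟨h2, hz⟩
      · exact ⟨hlen1, Or.inr hz, by rw [h2]; exact hcol, Or.inl rfl⟩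
      · exact ⟨hlen1, Or.inl hz, by rw [h2]; simpa using hcol, Or.inl rfl⟩

/-- ★★ **TWO ISOLATED TURNS IN THE RIGHTMOST COLUMN (or one and a vertical end there)** — the east twin of `two_left_turns`.
[cite: GlazmanManolescu2019, §1, Fig. 1; Lemma 2.1] -/
theorem two_right_turns (hh : holeFaceW w ∉ D) (hr : RootedFace D (w.side .W) r) (h : ω.IsB2a) :
    ∃ X : ℤ, w.1 ≤ X ∧ (∀ j < ω.2.arcs.length, (ω.2.fc j).1 ≤ X) ∧ ∃ T : Finset Face,
      (∀ f ∈ T, f ∈ facesL ω.2.mids ∧ (kindsL ω.2.mids f = [.corner] ∨ kindsL ω.2.mids f = [.coCorner])) ∧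
      (∀ f ∈ T, f.1 = X) ∧ (2 ≤ T.card ∨ (1 ≤ T.card ∧ (ω.1 = .N ∨ ω.1 = .S) ∧ r.1 = X)) := by
  classical
  obtain ⟨X, hXw, hX, i₀, hi₀, hcol₀, -, hW₀, hNS₀⟩ := exists_right_entry_turn hh hr h
  have hsv : ∀ i, i < ω.2.arcs.length → (ω.2.fc i).1 = X → ∀ j < ω.2.arcs.length, ω.2.fc j = ω.2.fc i → j = i :=
    fun i hi hcol j hj he => (right_single_visit hh hr h hX hi hj hcol he.symm).symm
  have hP₀ := isolated_turn hi₀ (hsv i₀ hi₀ hcol₀)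
    (by rw [hW₀]; exact YBWalk.arcKind_ne_straight_of_WE_S (Or.inl rfl) (hNS₀.elim Or.inr Or.inl))
  have hex : ∃ n, ∃ i, i < ω.2.arcs.length ∧ (ω.2.fc i).1 = X ∧ n = ω.2.arcs.length - i := ⟨_, i₀, hi₀, hcol₀, rfl⟩
  obtain ⟨i₁, hi₁, hcol₁, hn₁⟩ := Nat.find_spec hex
  have hmax : ∀ j, i₁ < j → j < ω.2.arcs.length → (ω.2.fc j).1 ≠ X := by
    intro j hj1 hj2 e
    have := Nat.find_min hex (m := ω.2.arcs.length - j) (by omega)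
    exact this ⟨j, hj2, e, rfl⟩
  refine ⟨X, hXw, hX, ?_⟩
  rcases right_exit_or_end hh hr h hX hi₁ hcol₁ hmax with ⟨hW₁, hNS₁⟩ | ⟨-, hz, hrX, -⟩
  · have hP₁ := isolated_turn hi₁ (hsv i₁ hi₁ hcol₁)
      (by rw [hW₁]; exact YBWalk.arcKind_ne_straight_of_S_WE (hNS₁.elim Or.inr Or.inl) (Or.inl rfl))
    have hne : i₀ ≠ i₁ := by
      rintro rfl
      rcases hNS₁ with e | e <;> rw [hW₀] at e <;> exact absurd e (by decide)
    have hfne : ω.2.fc i₀ ≠ ω.2.fc i₁ := fun e => hne (hsv i₁ hi₁ hcol₁ i₀ hi₀ e)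
    refine ⟨{ω.2.fc i₀, ω.2.fc i₁}, ?_, ?_, Or.inl (by rw [Finset.card_pair hfne])⟩
    · intro f hf
      rcases Finset.mem_insert.1 hf with rfl | hf
      · exact hP₀
      · rw [Finset.mem_singleton.1 hf]; exact hP₁
    · intro f hf
      rcases Finset.mem_insert.1 hf with rfl | hf
      · exact hcol₀
      · rw [Finset.mem_singleton.1 hf]; exact hcol₁
  · exact ⟨{ω.2.fc i₀}, fun f hf => by rw [Finset.mem_singleton.1 hf]; exact hP₀,
      fun f hf => by rw [Finset.mem_singleton.1 hf]; exact hcol₀, Or.inr ⟨by simp, hz, hrX⟩⟩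

end ΩG

end Literature.Probability.RandomPlanarGeometry.SAW.YangBaxter
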